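import Mathlib
import Summits.ValiantsHypothesis.ValiantsHypothesis.Theorems.FreeSubtorusSubtorusCoveringStubRelabel
import HarnessLib

/-!
# Crux `OrbitDimensionBound` (stmt-ValiantsHypothesis-16133), line `affine_multiple`, stub `stub_absorbingSacrifice`
# — piece (β2): RELABELLING rows and columns for an ARBITRARY represented polynomial

Helper toward the registered stub `stub_absorbingSacrifice` (lead: val-lit-p6 g11; split SPEC
`HOME/lmr/SPEC-p6g11-16133-stub2-split.md`, piece (β2)); `--supports stmt-ValiantsHypothesis-16133 --as helper`;
0 definitions / 0 named facts.

`relabel_general` is the floor's `stub_relabel` (`…FreeSubtorusSubtorusCoveringStubRelabel.lean`, crux 16134) with the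
represented polynomial `per_n` replaced by an ARBITRARY `f`, the target being `rename (Prod.map ρ κ) f` (the composition
of stub 2 represents `per_n · q`, whose relabelling is `per_n · (rename q)`).  The relabelled lattice datum is written in
the `Sum.elim` form of the floor's assembly `subtorusCovering_proof`:
`Λ' i = Sum.elim (fun k => Λ i (inl (ρ⁻¹ k))) (fun l => Λ i (inr (κ⁻¹ l)))`.  Same proof: affineness by
`totalDegree_rename_le`, determinant by `AlgHom.map_det`, lifts of generators transported through `rename`
(`linSubstEntries_map_rename_diagonal`, `IsEquivariantDetRepr.of_generators`).

Honest framing: plumbing inside one stub; `stub_absorbingSacrifice`, the crux and `VP ≠ VNP` remain OPEN.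
-/

set_option linter.dupNamespace false

namespace Summit.ValiantsHypothesis.ValiantsHypothesis.Theorems.FreeSubtorusOrbitDimensionBound.AbsorbingSacrifice

open Literature.Computability.AlgebraicComplexity MvPolynomial
open Summit.ValiantsHypothesis.ValiantsHypothesis.Theorems.FreeSubtorusSubtorusCovering

/-- **Relabelling, general represented polynomial** (piece (β2)).  Relabelling rows by `ρ` and columns by
`κ` (`B ↦ B.map (rename (Prod.map ρ κ))`) turns a `T_Λ`-equivariant affine determinantal representation of `f`
into a `T_{Λ'}`-equivariant one of `rename (Prod.map ρ κ) f`, `Λ' i = Sum.elim (Λ i ∘ inl ∘ ρ⁻¹) (Λ i ∘ inr ∘ κ⁻¹)`.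
[folklore] -/
theorem relabel_general (n r m : ℕ) (Λ : Fin r → (Fin n ⊕ Fin n) → ℤ) (f : MvPolynomial (Fin n × Fin n) ℂ)
    (B : Matrix (Fin m) (Fin m) (MvPolynomial (Fin n × Fin n) ℂ)) (ρ κ : Equiv.Perm (Fin n))
    (hB : IsEquivariantDetRepr (Subgroup.closure {γ : Matrix.GeneralLinearGroup (Fin n × Fin n) ℂ |
        ∃ d e : Fin n → ℂˣ,
          (∀ i, (∏ k, (d k) ^ (Λ i (Sum.inl k))) * (∏ l, (e l) ^ (Λ i (Sum.inr l))) = 1) ∧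
          (γ : Matrix (Fin n × Fin n) (Fin n × Fin n) ℂ) =
            Matrix.diagonal (fun p => (d p.1 : ℂ) * (e p.2 : ℂ))}) f B) :
    IsEquivariantDetRepr (Subgroup.closure {γ : Matrix.GeneralLinearGroup (Fin n × Fin n) ℂ |
        ∃ d e : Fin n → ℂˣ,
          (∀ i, (∏ k, (d k) ^ ((fun i => Sum.elim (fun k => Λ i (Sum.inl (ρ.symm k)))
              (fun l => Λ i (Sum.inr (κ.symm l)))) i (Sum.inl k))) *
            (∏ l, (e l) ^ ((fun i => Sum.elim (fun k => Λ i (Sum.inl (ρ.symm k)))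
              (fun l => Λ i (Sum.inr (κ.symm l)))) i (Sum.inr l))) = 1) ∧
          (γ : Matrix (Fin n × Fin n) (Fin n × Fin n) ℂ) =
            Matrix.diagonal (fun p => (d p.1 : ℂ) * (e p.2 : ℂ))})
      (MvPolynomial.rename (Prod.map ρ κ) f) (B.map (MvPolynomial.rename (Prod.map ρ κ))) := by
  refine IsEquivariantDetRepr.of_generators ⟨fun i j => ?_, ?_⟩ ?_
  · -- (a) affineness survives renaming
    rw [Matrix.map_apply]
    exact (totalDegree_rename_le _ _).trans (hB.1.1 i j)
  · -- (b) the determinant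
    rw [← AlgHom.mapMatrix_apply, ← AlgHom.map_det, hB.1.2]
  · -- (c) lifts of the generators of `T_{Λ'}`
    rintro γ' ⟨d', e', hrel', hγ'⟩
    have hrel : ∀ i, (∏ k, (d' (ρ k)) ^ (Λ i (Sum.inl k))) *
        (∏ l, (e' (κ l)) ^ (Λ i (Sum.inr l))) = 1 := by
      intro i
      rw [← hrel' i]
      simp only [Sum.elim_inl, Sum.elim_inr]
      congr 1
      · exact Fintype.prod_equiv ρ _ _ fun k => by rw [Equiv.symm_apply_apply]
      · exact Fintype.prod_equiv κ _ _ fun l => by rw [Equiv.symm_apply_apply]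
    let γ : GL (Fin n × Fin n) ℂ :=
      Grenet.diagUnit (fun p : Fin n × Fin n => (d' (ρ p.1) : ℂ) * (e' (κ p.2) : ℂ))
        (fun p => mul_ne_zero (d' (ρ p.1)).ne_zero (e' (κ p.2)).ne_zero)
    have hγ : (γ : Matrix (Fin n × Fin n) (Fin n × Fin n) ℂ) =
        Matrix.diagonal (fun p : Fin n × Fin n => (d' (ρ p.1) : ℂ) * (e' (κ p.2) : ℂ)) := rfl
    have hγmem : γ ∈ Subgroup.closure {γ : Matrix.GeneralLinearGroup (Fin n × Fin n) ℂ |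
        ∃ d e : Fin n → ℂˣ,
          (∀ i, (∏ k, (d k) ^ (Λ i (Sum.inl k))) * (∏ l, (e l) ^ (Λ i (Sum.inr l))) = 1) ∧
          (γ : Matrix (Fin n × Fin n) (Fin n × Fin n) ℂ) =
            Matrix.diagonal (fun p => (d p.1 : ℂ) * (e p.2 : ℂ))} :=
      Subgroup.subset_closure ⟨fun k => d' (ρ k), fun l => e' (κ l), hrel, hγ⟩
    obtain ⟨g, h, hgh⟩ := hB.2 γ hγmem
    refine ⟨g, h, ?_⟩
    have hC : (⇑(rename (Prod.map ρ κ) : MvPolynomial (Fin n × Fin n) ℂ →ₐ[ℂ]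
        MvPolynomial (Fin n × Fin n) ℂ)) ∘ (C : ℂ → MvPolynomial (Fin n × Fin n) ℂ) = C :=
      funext fun a => rename_C _ a
    rw [linSubstEntries_map_rename_diagonal (Prod.map ρ κ)
        (fun p : Fin n × Fin n => (d' (ρ p.1) : ℂ) * (e' (κ p.2) : ℂ))
        (fun q : Fin n × Fin n => (d' q.1 : ℂ) * (e' q.2 : ℂ)) (fun p => rfl) γ γ' hγ hγ' B,
      hgh, Matrix.map_mul, Matrix.map_mul, Matrix.map_map, Matrix.map_map, hC]

end Summit.ValiantsHypothesis.ValiantsHypothesis.Theorems.FreeSubtorusOrbitDimensionBound.AbsorbingSacrifice
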